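import Summits.Ventures.Crystal3D.Theorems.StickyWulffConstantTextureBuildSpecials
import Summits.Ventures.Crystal3D.Theorems.StickyWulffConstantTextureBuildTentZone
import Summits.Ventures.Crystal3D.Theorems.StickyWulffConstantTextureBuildPieceData
import Summits.Ventures.Crystal3D.Theorems.StickyWulffConstantTextureBuildLedgerSplitFree
import Summits.Ventures.Crystal3D.Theorems.StickyWulffConstantTextureBuildLedgerSplitFreeOr
import Summits.Ventures.Crystal3D.Theorems.StickyWulffConstantTextureBuildLedgerSplitWall
import Summits.Ventures.Crystal3D.Theorems.StickyWulffConstantTextureBuildWulffSupport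
import Summits.Ventures.Crystal3D.Theorems.StickyWulffConstantTextureBuildDesignated
import Summits.Ventures.Crystal3D.Theorems.StickyWulffConstantTextureBuildMassZone
import Summits.Ventures.Crystal3D.Theorems.StickyWulffConstantTextureBuildExposedTent
import Summits.Ventures.Crystal3D.Theorems.StickyWulffConstantTextureBuildCutInput
import Summits.Ventures.Crystal3D.Theorems.StickyWulffConstantTextureBuildMeshV6
import HarnessLib

/-!
# TB-energy ASSEMBLY: `stub_TB_energy` (v8.12/v8.13 statement) from T0 (`BarlowFreeCertificateCover`) and the RISER PACKAGE — sorry-free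
# (lane T, crux `TextureLiminfV5`, stmt-Ventures-23912; blueprint HOME/wulff-p2/g20–g21/TexShadowTB.lean made real; memo HOME/wulff-p2/g21/TB-D-4-g21.md)

HONEST FRAMING. Venture `Summits/Ventures/Crystal3D` (cell `crystal3d-full`), route `route-Ventures-StickyWulffConstant`, helper `--supports` the
law-v5 crux `TextureLiminfV5` (stmt-Ventures-23912).  DEFINITIONS (`TexInput.Good`, `TexInput.construct`, the named debt `RiserPackage`) + the assembly
(standard axioms).  This file does NOT close `stub_TB_energy`: it is a CONDITIONAL theorem whose two hypotheses are named obligations of other seats —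
T0 = `BarlowFreeCertificateCover` (23912-p1's `…_holds`) and B6 = `RiserPackage` (the riser package: claim rule + curtain bound; no seat has landed it).
F-C1 not moved.

* `TexInput.Good` — what the energy side needs of an input: `1 ≤ R₀`, cut levels in `(0,1)` with the Cavalieri clause (…CutInput), the riser package's
  contact row `BoxRow` and curtain bound `curtainSpecialSum ≤ riserSum` (…Specials);
* `lp1` (exposed classification, PROVED: …ExposedFar/Container/Tent), `lp2` (contact classification, from `Good.hbox` via `lp2_of_boxRow`), `ls`
  (specials, from `Good.hcut/hcurtain` via `ls_of_curtain`), `ledger_le` (the piece ledger: `free_le_split′` + `wall_le_split` + `tent_zone_le` + `desArea_le`),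
  `construct : Good → mass → PieceData rc μ.toMesh₄`;
* **`RiserPackage`** (closed `Prop`, the B6 debt): for every risered cover, v5 mesh, certified tents and cut levels, SOME riser planes and claim rule make
  `BoxRow` and the curtain bound true;  `exists_good : BarlowFreeCertificateCover → RiserPackage → 1 ≤ R₀ → ∃ I, I.Good`;
* `tb_energy_of_good` (pointwise, from `∃ I, I.Good`; mesh-version-agnostic) and
  **`tb_energy_of_riserPackage : BarlowFreeCertificateCover → RiserPackage → (stub_TB_energy's registered statement over Mesh₆, 1 ≤ R₀)`**.
-/

noncomputable section

open scoped BigOperators InnerProductSpace ENNReal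

namespace Summit.Ventures.Crystal3D.Cruxes.TextureLiminf.TexShadow

open Summit.Ventures.Crystal3D Summit.Ventures.Crystal3D.Theorems MeasureTheory Set
open Summit.Ventures.Crystal3D.TentCertificate (isOpen_laySlab)

namespace TexInput

variable {C R₀ : ℝ} {N : ℕ} {x : Fin N → E3} {rc : RiseredCover C R₀ N x} {δ : ℝ} {μ : Mesh₅ rc δ} (I : TexInput rc μ)

/-! ### Good inputs -/

/-- **GOOD INPUT** (energy side): the regime `1 ≤ R₀`, cut levels in `(0,1)` with their Cavalieri bound (…CutInput `Mesh₄.exists_good_cut`), and the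
riser package's two clauses about ITS `extra` / `boxGrain` (…Specials `BoxRow`, curtain bound). -/
structure Good : Prop where
  hR₀ : 1 ≤ R₀
  hτ : ∀ k, I.τ k ∈ Set.Ioo (0 : ℝ) 1
  hcut : ∀ k, ∀ F : Finset (ℤ × ℤ),
    ∑ ij ∈ F, (rc.cell k).c ij.1 ij.2 * facetArea (closure (polytope (μ.HP k)) ∩
      closure (laySlab (rc.tent (μ.fk k)).L (rc.tent (μ.fk k)).s ij.1) ∩ closure (laySlab (rc.tent (μ.gk k)).L (rc.tent (μ.gk k)).s ij.2) ∩
      {y : E3 | ⟪(I.cutDatum k).1, y⟫_ℝ = (I.cutDatum k).2}) (I.cutDatum k).1 ≤ (rc.cell k).charge + 13 / 25 * μ.ex k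
  hbox : I.BoxRow
  hcurtain : I.curtainSpecialSum ≤ rc.riserSum

/-! ### The three classification lines -/

/-- **(L-P1) — exposed classification**: the exposed part of every piece facet lies a.e. in its class's tent zone or in a designated region of EITHER
orientation (rows K …ExposedFar, P/Q/B …ExposedContainer, T …ExposedTent). -/
theorem lp1 : ∀ i, ∀ p ∈ I.cells.Hp i,
    facetArea (((closure (polytope (I.cells.Hp i)) ∩ {y : E3 | ⟪p.1, y⟫_ℝ = p.2}) \
        ⋃ i' ∈ Finset.univ.erase i, closure (polytope (I.cells.Hp i'))) \
      (I.zone (I.cells.cls i) ∪ ⋃ d ∈ μ.desSet.filter (fun d => (d.2.1 = p.1 ∧ d.2.2 = p.2) ∨ (-d.2.1 = p.1 ∧ -d.2.2 = p.2)), facetOf d.1 d.2)) p.1 = 0 := by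
  intro i p hp
  by_cases hcore : ∃ (f : Fin rc.ng) (jc : Fin (μ.nC f)), polytope (I.cells.Hp i) ⊆ polytope (μ.HC f jc)
  · -- ROW (K): core cells (…ExposedFar `exposed_core_eq_zero`)
    obtain ⟨f, jc, hc⟩ := hcore
    have h0 := I.exposed_core_eq_zero i hc hp
    refine le_antisymm ?_ (facetArea_nonneg _ _)
    rw [← h0]
    refine facetArea_mono_of_subset (I.cells.hbd_Hp i) (fun z hz => hz.1.1.1) (fun z hz => ?_) p.1
    exact ⟨hz.1, fun h => hz.2 (Or.inr h)⟩
  · -- not a core cell: prism / gap / box rows (…ExposedContainer), else a TENT cell (row (T), …ExposedTent)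
    have hmono : ∀ {S : Set E3}, facetArea (I.exposed i p \ μ.desOf p) p.1 = 0 →
        facetArea (I.exposed i p \ (S ∪ μ.desOf p)) p.1 = 0 := fun {S} h0 => by
      refine le_antisymm ?_ (facetArea_nonneg _ _)
      rw [← h0]
      refine facetArea_mono_of_subset (I.cells.hbd_Hp i) (fun z hz => hz.1.1.1) (fun z hz => ?_) p.1
      exact ⟨hz.1, fun h => hz.2 (Or.inr h)⟩
    by_cases hprism : ∃ k, polytope (I.cells.Hp i) ⊆ polytope (μ.HP k)
    · obtain ⟨k, hk⟩ := hprism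
      exact hmono (I.exposed_prism_eq_zero i hk hp)
    by_cases hgap : ∃ l, polytope (I.cells.Hp i) ⊆ polytope (μ.HQ l)
    · obtain ⟨l, hl⟩ := hgap
      exact hmono (I.exposed_gap_eq_zero i hl hp)
    by_cases hbox : ∃ r, polytope (I.cells.Hp i) ⊆ polytope (μ.HB r)
    · obtain ⟨r, hr⟩ := hbox
      exact hmono (I.exposed_box_eq_zero i hr hp)
    -- ROW (T): tent cells (incl. T2 via T0's LayerPlaneCover) — …ExposedTent
    exact I.exposed_tent_eq_zero i hcore hprism hgap hbox hp


/-- **(L-P2) — contact classification** (from the riser package's row). -/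
theorem lp2 (hI : I.Good) : ∀ i i', I.cells.cls i' ≠ I.cells.cls i → ∀ p ∈ I.cells.Hp i,
    I.IsSpecial i i' p ∨ lawW I.frameOf (I.cells.cls i) (I.cells.cls i') p.1 = 0 ∨
      facetArea ((closure (polytope (I.cells.Hp i)) ∩ {y : E3 | ⟪p.1, y⟫_ℝ = p.2} ∩ closure (polytope (I.cells.Hp i'))) \
        ⋃ d ∈ μ.desSet.filter (fun d => (d.2.1, d.2.2) = p ∨ (-d.2.1, -d.2.2) = p), facetOf d.1 d.2) p.1 = 0 :=
  I.lp2_of_boxRow hI.hτ hI.hR₀ hI.hbox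

/-- **(L-S) — the special contacts are paid** (cuts by the charges + slice excess, curtains by the riser budget). -/
theorem ls (hI : I.Good) : I.specialSum ≤ rc.chargeSum + 13 / 25 * ∑ k, μ.ex k + rc.riserSum :=
  I.ls_of_curtain hI.hcut hI.hcurtain

/-! ### The assembly -/

/-- `√5 + 13/25 ≤ 3`. -/
theorem sqrt_five_add_le_three : Real.sqrt 5 + 13 / 25 ≤ (3 : ℝ) := by
  have h : Real.sqrt 5 ≤ 2.24 := by
    rw [show (2.24 : ℝ) = Real.sqrt (2.24 ^ 2) by rw [Real.sqrt_sq (by norm_num)]]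
    exact Real.sqrt_le_sqrt (by norm_num)
  linarith

open scoped Classical in
/-- **THE LEDGER of the labelled cells**: `FREE + WALL ≤ tentBudget + chargeSum + riserSum + gapCost`. -/
theorem ledger_le (hI : I.Good) :
    (∑ i, ∑ p ∈ I.cells.Hp i, supportFn (wulffOf (I.frameOf (I.cells.cls i))) p.1 *
        facetArea ((closure (polytope (I.cells.Hp i)) ∩ {y : E3 | ⟪p.1, y⟫_ℝ = p.2}) \
          ⋃ i' ∈ Finset.univ.erase i, closure (polytope (I.cells.Hp i'))) p.1) +
      ∑ i, ∑ i' ∈ Finset.univ.filter (fun i' => I.cells.cls i' ≠ I.cells.cls i), I.charge (I.cells.cls i) (I.cells.cls i') / 2 *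
        ∑ p ∈ I.cells.Hp i, supportFn (wallBody (I.axis (I.cells.cls i) (I.cells.cls i'))) p.1 *
          facetArea (closure (polytope (I.cells.Hp i)) ∩ {y : E3 | ⟪p.1, y⟫_ℝ = p.2} ∩ closure (polytope (I.cells.Hp i'))) p.1 ≤
    rc.tentBudget + rc.chargeSum + rc.riserSum + μ.gapCost := by
  obtain ⟨hfin, hT⟩ := I.tent_zone_le
  -- FREE half
  have hfree := free_le_split' (fun c => wulffOf (I.frameOf c)) (fun c => isCompact_wulffOf _) (fun c => convex_wulffOf _)
    (fun c => zero_mem_wulffOf _) (κW := Real.sqrt 5) (Real.sqrt_nonneg 5)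
    (fun c ν hν => by have := supportFn_wulffOf_le (I.frameOf c) ν; rw [hν, mul_one] at this; exact this)
    I.cells.Hp I.cells.cls I.cells.hbd_Hp I.cells.hunit_Hp I.cells.hplanes_Hp I.cells.hdisj_Hp
    μ.desSet (fun d => facetOf d.1 d.2) (fun d => d.2.1) (fun d => d.2.2) (fun d hd => (μ.desRegion_spec hd).1) (fun d hd => (μ.desSet_spec hd).2.2)
    (fun d hd => (μ.desRegion_spec hd).2.1) (fun d hd => (μ.desRegion_spec hd).2.2) I.zone I.isOpen_zone hfin I.lp1
  -- WALL half, after rewriting `c/2 · Σ h·area` as `Σ lawW·area`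
  have hwall₀ := wall_le_split (lawW I.frameOf) (fun ℓ ℓ' ν => lawW_nonneg _ _ _ _) (κc := 13 / 25) (by norm_num)
    (fun ℓ ℓ' ν hν => lawW_le _ _ _ hν)
    I.cells.Hp I.cells.cls I.cells.hbd_Hp I.cells.hunit_Hp I.cells.hplanes_Hp I.cells.hdisj_Hp
    μ.desSet (fun d => facetOf d.1 d.2) (fun d => d.2.1) (fun d => d.2.2) (fun d hd => (μ.desRegion_spec hd).1) (fun d hd => (μ.desSet_spec hd).2.2)
    (fun d hd => (μ.desRegion_spec hd).2.1) (fun d hd => (μ.desRegion_spec hd).2.2) I.IsSpecial (I.lp2 hI)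
  have hrew : (∑ i, ∑ i' ∈ Finset.univ.filter (fun i' => I.cells.cls i' ≠ I.cells.cls i), I.charge (I.cells.cls i) (I.cells.cls i') / 2 *
        ∑ p ∈ I.cells.Hp i, supportFn (wallBody (I.axis (I.cells.cls i) (I.cells.cls i'))) p.1 *
          facetArea (closure (polytope (I.cells.Hp i)) ∩ {y : E3 | ⟪p.1, y⟫_ℝ = p.2} ∩ closure (polytope (I.cells.Hp i'))) p.1) =
      ∑ i, ∑ i' ∈ Finset.univ.filter (fun i' => I.cells.cls i' ≠ I.cells.cls i), ∑ p ∈ I.cells.Hp i,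
        lawW I.frameOf (I.cells.cls i) (I.cells.cls i') p.1 *
          facetArea (closure (polytope (I.cells.Hp i)) ∩ {y : E3 | ⟪p.1, y⟫_ℝ = p.2} ∩ closure (polytope (I.cells.Hp i'))) p.1 := by
    refine Finset.sum_congr rfl fun i _ => Finset.sum_congr rfl fun i' _ => ?_
    exact lawC_div_two_mul_sum I.frameOf (I.cells.Hp i) _ _ (fun p => p.1) _
  rw [hrew]
  have hS := I.ls hI
  have hD := μ.desArea_le
  have hD0 := μ.desArea_nonneg
  have hgap : μ.gapCost = 3 * (μ.gapArea + ∑ k, μ.latArea k) + 13 / 25 * ∑ k, μ.ex k := rfl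
  have h3 := sqrt_five_add_le_three
  have hspec : (∑ i, ∑ i' ∈ Finset.univ.filter (fun i' => I.cells.cls i' ≠ I.cells.cls i),
      ∑ p ∈ (I.cells.Hp i).filter (fun p => I.IsSpecial i i' p), lawW I.frameOf (I.cells.cls i) (I.cells.cls i') p.1 *
        facetArea (closure (polytope (I.cells.Hp i)) ∩ {y : E3 | ⟪p.1, y⟫_ℝ = p.2} ∩ closure (polytope (I.cells.Hp i'))) p.1) = I.specialSum := rfl
  rw [hspec] at hwall₀
  unfold Mesh₅.desArea at hD hD0
  rw [hgap]
  have hprod : (Real.sqrt 5 + 13 / 25) * (∑ d ∈ μ.desSet, facetArea (facetOf d.1 d.2) d.2.1) ≤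
      3 * (∑ d ∈ μ.desSet, facetArea (facetOf d.1 d.2) d.2.1) := mul_le_mul_of_nonneg_right h3 hD0
  linarith [hfree, hwall₀, hT, hS, hD, hD0, hprod]

open scoped Classical in
/-- **THE CONSTRUCTION**: piece data from a good input (the labelled cells, the canonical class frames, the law data). -/
def construct (hI : I.Good) (hLM : (1 - δ) * (N : ℝ) ≤ Real.sqrt 2 * (volume (⋃ i, polytope (I.cells.Hp i))).toReal) :
    PieceData rc μ.toMesh₄ where
  n := I.cells.n
  A := I.frameOf
  c := I.charge
  m := I.axis
  hc := fun _ _ _ => lawC_nonneg _ _ _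
  hlaw₀ := fun _ _ _ h => law_not_coAx I.frameOf h
  hlaw₁ := fun _ _ _ hco hne => law_coAx_ne I.frameOf hco hne
  M := I.cells.M
  Hp := I.cells.Hp
  cls := I.cells.cls
  hbd := I.cells.hbd_Hp
  hunit := I.cells.hunit_Hp
  hplanes := I.cells.hplanes_Hp
  hdisj := I.cells.hdisj_Hp
  hmass := hLM
  hledger := I.ledger_le hI

end TexInput

/-! ### The riser package as a named debt, the input, the final theorem -/

/-- **THE RISER PACKAGE (B6), as a closed statement**: for every risered cover and v5 mesh, every family of certified tents and every cut levels in
`(0,1)` (regime `1 ≤ R₀`), SOME riser planes `extra` and claim rule `boxGrain` make the texture input's riser-box contact row `BoxRow` true and its curtain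
specials cost at most `riserSum` (design of record: TB-D-1-g20 §1(R), §2(R1)–(R4) — small-triangle prisms per layer plane of the riser frame, claim by the
occupied vertex, curtains = honeycomb walls between differently claimed prisms, `½·area ≤` the vacant-site count `riserBudget`; sub-brick (L-ax)). -/
def RiserPackage : Prop :=
  ∀ {C R₀ : ℝ} {N : ℕ} {x : Fin N → E3} (rc : RiseredCover C R₀ N x) {δ : ℝ} (μ : Mesh₅ rc δ)
    (ct : (f : Fin rc.ng) → TentCert (rc.tent f)) (τ : Fin rc.nk → ℝ), 1 ≤ R₀ → (∀ k, τ k ∈ Set.Ioo (0 : ℝ) 1) →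
    ∃ (extra : Finset (E3 × ℝ)) (hextra : ∀ p ∈ extra, ‖p.1‖ = 1) (boxGrain : Fin rc.nr → Finset (E3 × ℝ) → Fin rc.ng),
      (TexInput.mk ct τ extra hextra boxGrain : TexInput rc μ).BoxRow ∧
        (TexInput.mk ct τ extra hextra boxGrain : TexInput rc μ).curtainSpecialSum ≤ rc.riserSum

/-- **A GOOD INPUT EXISTS** given T0 and the riser package (regime `1 ≤ R₀`): certified tents = T0's at the canonical frames, cut levels from
`Mesh₄.exists_good_cut`, riser planes and claim rule from the riser package. -/
theorem exists_good (hT0 : BarlowFreeCertificateCover) (hB6 : RiserPackage) {C R₀ : ℝ} (hR₀ : 1 ≤ R₀) {N : ℕ} {x : Fin N → E3}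
    (rc : RiseredCover C R₀ N x) {δ : ℝ} (μ : Mesh₅ rc δ) : ∃ I : TexInput rc μ, I.Good := by
  classical
  set ct : (f : Fin rc.ng) → TentCert (rc.tent f) := fun f => tentCert hT0 (rc.tent f) with hct
  set τ : Fin rc.nk → ℝ := fun k => Classical.choose (μ.toMesh₄.exists_good_cut hR₀ k) with hτdef
  have hτ : ∀ k, τ k ∈ Set.Ioo (0 : ℝ) 1 := fun k => (Classical.choose_spec (μ.toMesh₄.exists_good_cut hR₀ k)).1
  obtain ⟨extra, hextra, boxGrain, hbox, hcurtain⟩ := hB6 rc μ ct τ hR₀ hτ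
  refine ⟨TexInput.mk ct τ extra hextra boxGrain, ?_⟩
  exact
    { hR₀ := hR₀
      hτ := hτ
      hcut := fun k F => (Classical.choose_spec (μ.toMesh₄.exists_good_cut hR₀ k)).2 F
      hbox := hbox
      hcurtain := hcurtain }

/-- **THE ENERGY HALF FROM A GOOD INPUT, pointwise** (mesh-version-agnostic core: any future riser-package variant over a richer mesh only has to produce
`∃ I, I.Good` for the underlying v5 mesh). -/
theorem tb_energy_of_good {C R₀ : ℝ} {N : ℕ} {x : Fin N → E3} {δ : ℝ} (rc : RiseredCover C R₀ N x) (μ : Mesh₆ rc δ)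
    (hgood : ∃ I : TexInput rc μ.toMesh₅, I.Good) :
    ∃ (n : ℕ) (G : Fin n → Set E3) (A : Fin n → (E3 ≃ₗᵢ[ℝ] E3)) (c : Fin n → Fin n → ℝ) (m : Fin n → Fin n → E3),
      IsTexture (13 / 25) (1 / 2) n G A c m ∧ (1 - δ) * (N : ℝ) ≤ Real.sqrt 2 * vol n G ∧
      energy n G A c m ≤ rc.tentBudget + rc.chargeSum + rc.riserSum + μ.gapCost :=
  ((Classical.choose hgood).construct (Classical.choose_spec hgood) (Classical.choose hgood).mass_le).tbEnergy

/-- **`stub_TB_energy` FROM T0 AND THE RISER PACKAGE** (the registered v8.12/v8.13 statement = `henergy` of `shadowTheoremSatAtomicV5_of_risered₆R_slack`: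
binders `Mesh₆`, `1 ≤ R₀`): the input (`exists_good`), the construction `TexInput.construct`, the mass line `TexInput.mass_le` (…MassZone) and
`PieceData.tbEnergy`. -/
theorem tb_energy_of_riserPackage (hT0 : BarlowFreeCertificateCover) (hB6 : RiserPackage) :
    PolytopeCalculus → BarlowFreeCertificate →
      ∀ (C R₀ : ℝ), 1 ≤ R₀ → ∀ (N : ℕ) (x : Fin N → E3) (δ : ℝ) (rc : RiseredCover C R₀ N x) (μ : Mesh₆ rc δ),
        ∃ (n : ℕ) (G : Fin n → Set E3) (A : Fin n → (E3 ≃ₗᵢ[ℝ] E3)) (c : Fin n → Fin n → ℝ) (m : Fin n → Fin n → E3),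
          IsTexture (13 / 25) (1 / 2) n G A c m ∧ (1 - δ) * (N : ℝ) ≤ Real.sqrt 2 * vol n G ∧
          energy n G A c m ≤ rc.tentBudget + rc.chargeSum + rc.riserSum + μ.gapCost :=
  fun _ _ _ _ hR₀ _ _ _ rc μ => tb_energy_of_good rc μ (exists_good hT0 hB6 hR₀ rc μ.toMesh₅)

end Summit.Ventures.Crystal3D.Cruxes.TextureLiminf.TexShadow

end
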